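import Summits.CriticalPhenomena.SAWScalingLimit.Theorems.SAWReversalUpgradeAttachNoReturnPieces
import Summits.CriticalPhenomena.SAWScalingLimit.Theorems.SAWReversalUpgradeAttachNoReturnArc
import HarnessLib

/-!
# Route `SAWReversalUpgrade`, support `AttachNoReturn` (stmt-CriticalPhenomena-18057):
# traversal order of a standard attachment and transfer of endpoint events to the polyline

Helper file for the proof of
`Summit.CriticalPhenomena.SAWScalingLimit.Theses.SAWReversalUpgrade.AttachNoReturn`.

For a standard attachment `c ∈ AttachReversal.standardCurves a b Φ e R D` in the non-degenerate
case `uMid < vMid`, the trace `attSet` splits as `Head ∪ attZ '' [uMid, vMid] ∪ Tail` with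
`Head = {a} ∪ (access segment)` and `Tail = (exit ray) ∪ {b}`. When the access segment stays
within `ρa` of `a` and the exit ray within `ρb` of `b`, `ρa + ρb < dist a b` (hypotheses `hρa`,
`hρb`, `hsep`, discharged for small mesh in the next file), the abstract traversal-order lemma
`AttachNoReturn.arc_order` applies (`Head`, `Tail` are preconnected images of a segment / a closed
ray, the middle piece `attZ` is continuous and flat), and yields the two deterministic event
transfers consumed by `AttachNoReturn`:

* `event_pt_zero` — if `c` is `ε`-far from `a` at time `s` and `r`-close to `a` at a later time
  `t` (`ρa < ε`, `r + ρb < dist a b`), then `c s = attZ σ`, `c t = attZ τ` for some `σ < τ`;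
* `event_pt_one` — the same for "`r`-close to `b`, later `ε`-far from `b`".
-/

noncomputable section

open Set Filter Metric Complex Function
open scoped Topology unitInterval
open UpperHalfPlane (upperHalfPlaneSet)
open Literature.Probability.RandomPlanarGeometry

namespace Summit.CriticalPhenomena.SAWScalingLimit.Theorems

namespace AttachNoReturn

open AttachReversal FaithfulAttach

variable {D : DobrushinDomain} {φ : ConformalEquiv upperHalfPlaneSet D.carrier} {e : ℝ}
  {P : C(I, ℂ)} {R : ℝ → ℂ} {ρa ρb : ℝ}

section Structure

variable (hφ : D.IsChordalUniformizing φ) (he0 : 0 < e) (he1 : e ≤ 1 / 2)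
  (hR : ∀ u, R u = P (projIcc 0 1 zero_le_one u))
  (hPcl : ∀ t, P t ∈ closure D.carrier) (hP0 : P 0 ∈ D.carrier) (hP1 : P 1 ∈ D.carrier)
  (hρa : ∀ z : ℂ, 0 ≤ z.im → ‖z‖ ≤ ‖hinv φ.boundaryExtension (P 0)‖ →
    dist (φ.boundaryExtension z) (D.pt 0) ≤ ρa)
  (hρb : ∀ z : ℂ, 0 ≤ z.im → ‖hinv φ.boundaryExtension (P 1)‖ ≤ ‖z‖ →
    dist (φ.boundaryExtension z) (D.pt 1) ≤ ρb)

/-- The trace of the `let`-block, regrouped as `Head ∪ middle ∪ Tail`. -/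
theorem attSet_eq :
    attSet (D.pt 0) (D.pt 1) φ.boundaryExtension e R =
      ({D.pt 0} ∪ (fun s : ℝ => φ.boundaryExtension ((s : ℂ) * pAcc (D.pt 0) φ.boundaryExtension e R)) ''
          Ioc 0 (sAcc (D.pt 0) (D.pt 1) φ.boundaryExtension e R)) ∪
      attZ (D.pt 1) φ.boundaryExtension e R ''
        Icc (uMid (D.pt 0) (D.pt 1) φ.boundaryExtension e R) (vMid (D.pt 0) (D.pt 1) φ.boundaryExtension e R) ∪
      ((fun r : ℝ => φ.boundaryExtension ((r : ℂ) * qEx (D.pt 1) φ.boundaryExtension e R)) ''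
          {r | rEx (D.pt 0) (D.pt 1) φ.boundaryExtension e R ≤ r ∧ R (firstB (D.pt 1) R) ≠ D.pt 1} ∪
        {D.pt 1}) := by
  ext x
  simp only [attSet, mem_union, mem_insert_iff, mem_singleton_iff]
  tauto

/-- **Non-degeneracy forces `i ≤ j`**: if `[i, j]` were empty, both cut times `uMid`, `vMid`
would be the junk value `0`. -/
theorem lastA_le_firstB_of_lt {Φ : ℂ → ℂ}
    (huv : uMid (D.pt 0) (D.pt 1) Φ e R < vMid (D.pt 0) (D.pt 1) Φ e R) :
    lastA (D.pt 0) R ≤ firstB (D.pt 1) R := by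
  by_contra h
  rw [not_le] at h
  have hempty : Icc (lastA (D.pt 0) R) (firstB (D.pt 1) R) = ∅ := Icc_eq_empty_of_lt h
  have hu : uMid (D.pt 0) (D.pt 1) Φ e R = 0 := by
    rw [uMid, hempty]
    simp only [mem_empty_iff_false, false_and, setOf_false, Real.sInf_empty]
  have hv : vMid (D.pt 0) (D.pt 1) Φ e R = 0 := by
    rw [vMid, hempty]
    simp only [mem_empty_iff_false, false_and, setOf_false, union_self, Real.sSup_empty]
  rw [hu, hv] at huv
  exact lt_irrefl _ huv

include hφ he0 he1 hR hPcl hP0 hρa in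
/-- **The head stays within `ρa` of `a`.** -/
theorem dist_head_le {x : ℂ}
    (hx : x ∈ {D.pt 0} ∪ (fun s : ℝ => φ.boundaryExtension ((s : ℂ) * pAcc (D.pt 0) φ.boundaryExtension e R)) ''
      Ioc 0 (sAcc (D.pt 0) (D.pt 1) φ.boundaryExtension e R)) (hij : lastA (D.pt 0) R ≤ firstB (D.pt 1) R) :
    dist x (D.pt 0) ≤ ρa := by
  obtain ⟨hpim, hpn, hp0, -⟩ := pAcc_spec hφ he0 he1 hR hPcl hP0
  obtain ⟨-, hs1, -⟩ := sAcc_spec hφ he0 he1 hR hPcl hP0 hij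
  -- `‖p‖ ≤ ‖ψ (P 0)‖`
  have hple : ‖pAcc (D.pt 0) φ.boundaryExtension e R‖ ≤ ‖hinv φ.boundaryExtension (P 0)‖ := by
    rcases lastA_dichotomy (D := D) hR with h | ⟨h0, -⟩
    · rw [hp0.2 h, norm_zero]; exact norm_nonneg _
    · rw [hpn, h0, (trim_R_zero_one hR).1]
  rcases hx with hx | ⟨s, hs, rfl⟩
  · rw [mem_singleton_iff] at hx
    subst hx
    have := hρa 0 (by simp) (by rw [norm_zero]; exact norm_nonneg _)
    rwa [hφ.boundaryExtension_zero] at this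
  · refine hρa _ (ray_im_nonneg hpim hs.1.le) ?_
    rw [norm_mul, Complex.norm_real, Real.norm_of_nonneg hs.1.le]
    calc s * ‖pAcc (D.pt 0) φ.boundaryExtension e R‖ ≤ 1 * ‖pAcc (D.pt 0) φ.boundaryExtension e R‖ :=
          mul_le_mul_of_nonneg_right (hs.2.trans hs1) (norm_nonneg _)
      _ ≤ ‖hinv φ.boundaryExtension (P 0)‖ := by rw [one_mul]; exact hple

include hφ he0 he1 hR hPcl hP1 hρb in
/-- **The tail stays within `ρb` of `b`.** -/
theorem dist_tail_le {x : ℂ}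
    (hx : x ∈ (fun r : ℝ => φ.boundaryExtension ((r : ℂ) * qEx (D.pt 1) φ.boundaryExtension e R)) ''
        {r | rEx (D.pt 0) (D.pt 1) φ.boundaryExtension e R ≤ r ∧ R (firstB (D.pt 1) R) ≠ D.pt 1} ∪ {D.pt 1})
    (hij : lastA (D.pt 0) R ≤ firstB (D.pt 1) R) :
    dist x (D.pt 1) ≤ ρb := by
  rcases hx with ⟨r, ⟨hr, hjb⟩, rfl⟩ | hx
  · obtain ⟨hqim, -, hqn, -⟩ := qEx_spec hφ he0 he1 hR hPcl hP1 hjb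
    obtain ⟨hr1, -⟩ := vMid_spec_of_ne hφ he0 he1 hR hPcl hP1 hij hjb
    have hr0 : 0 ≤ r := zero_le_one.trans (hr1.trans hr)
    refine hρb _ (ray_im_nonneg hqim hr0) ?_
    rw [norm_mul, Complex.norm_real, Real.norm_of_nonneg hr0, ← hqn]
    calc ‖qEx (D.pt 1) φ.boundaryExtension e R‖ = 1 * ‖qEx (D.pt 1) φ.boundaryExtension e R‖ := (one_mul _).symm
      _ ≤ r * ‖qEx (D.pt 1) φ.boundaryExtension e R‖ := mul_le_mul_of_nonneg_right (hr1.trans hr) (norm_nonneg _)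
  · rw [mem_singleton_iff] at hx
    subst hx
    obtain ⟨him, heq⟩ := hinv_spec hφ (subset_closure hP1) (fun h => MarkedDomain.pt_notMem_carrier D 1 (h ▸ hP1))
    have := hρb _ him le_rfl
    rw [dist_self] at *
    exact dist_nonneg.trans this

include hφ he0 he1 hR hPcl hP0 hP1 hρa hρb in
/-- **Traversal order of a standard attachment** (instance of `arc_order`): the junction times
`ta < tb` with `c ta = Ja = attZ uMid`, `c tb = Jb = attZ vMid`, and the five order facts. -/
theorem standard_order (hsep : ρa + ρb < dist (D.pt 0) (D.pt 1))
    (hflat : ∀ s t : I, P s = P t → ∀ w : I, s ≤ w → w ≤ t → P w = P s)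
    {c : Curve ℂ} (hc : c ∈ standardCurves (D.pt 0) (D.pt 1) φ.boundaryExtension e R D.carrier)
    (huv : uMid (D.pt 0) (D.pt 1) φ.boundaryExtension e R < vMid (D.pt 0) (D.pt 1) φ.boundaryExtension e R) :
    Icc (uMid (D.pt 0) (D.pt 1) φ.boundaryExtension e R) (vMid (D.pt 0) (D.pt 1) φ.boundaryExtension e R) ⊆
        Icc (0 : ℝ) 1 ∧
    ∃ ta tb : I, ta < tb ∧
      c ta = attZ (D.pt 1) φ.boundaryExtension e R (uMid (D.pt 0) (D.pt 1) φ.boundaryExtension e R) ∧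
      c tb = attZ (D.pt 1) φ.boundaryExtension e R (vMid (D.pt 0) (D.pt 1) φ.boundaryExtension e R) ∧
      (∀ t, t < ta → dist (c t) (D.pt 0) ≤ ρa) ∧
      (∀ t, tb < t → dist (c t) (D.pt 1) ≤ ρb) ∧
      (∀ t, t ≤ ta → dist (c t) (D.pt 0) ≤ ρa) ∧
      (∀ t, tb ≤ t → dist (c t) (D.pt 1) ≤ ρb) ∧
      (∀ t, ta < t → t < tb → c t ∈ attZ (D.pt 1) φ.boundaryExtension e R ''
        Icc (uMid (D.pt 0) (D.pt 1) φ.boundaryExtension e R) (vMid (D.pt 0) (D.pt 1) φ.boundaryExtension e R)) ∧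
      (∀ s t, s < t →
        c s ∈ attZ (D.pt 1) φ.boundaryExtension e R ''
          Icc (uMid (D.pt 0) (D.pt 1) φ.boundaryExtension e R) (vMid (D.pt 0) (D.pt 1) φ.boundaryExtension e R) →
        c t ∈ attZ (D.pt 1) φ.boundaryExtension e R ''
          Icc (uMid (D.pt 0) (D.pt 1) φ.boundaryExtension e R) (vMid (D.pt 0) (D.pt 1) φ.boundaryExtension e R) →
        ∃ x ∈ Icc (uMid (D.pt 0) (D.pt 1) φ.boundaryExtension e R) (vMid (D.pt 0) (D.pt 1) φ.boundaryExtension e R),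
          ∃ y ∈ Icc (uMid (D.pt 0) (D.pt 1) φ.boundaryExtension e R) (vMid (D.pt 0) (D.pt 1) φ.boundaryExtension e R),
            x < y ∧ attZ (D.pt 1) φ.boundaryExtension e R x = c s ∧ attZ (D.pt 1) φ.boundaryExtension e R y = c t) := by
  have hij : lastA (D.pt 0) R ≤ firstB (D.pt 1) R := lastA_le_firstB_of_lt huv
  have hIcc01 : Icc (lastA (D.pt 0) R) (firstB (D.pt 1) R) ⊆ Icc (0 : ℝ) 1 := Icc_lastA_firstB_subset hR
  -- the data of the pieces (before abbreviating)
  obtain ⟨hpim, hpn, hp0, hΦp⟩ := pAcc_spec hφ he0 he1 hR hPcl hP0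
  obtain ⟨hs0, hs1, hsin, hsout, hs00⟩ := sAcc_spec hφ he0 he1 hR hPcl hP0 hij
  obtain ⟨hu₁mem, hZu₁⟩ := uMid_spec hφ he0 he1 hR hPcl hP0 hij
  have hTail_cases : (R (firstB (D.pt 1) R) = D.pt 1 ∧
      vMid (D.pt 0) (D.pt 1) φ.boundaryExtension e R = firstB (D.pt 1) R ∧
      attZ (D.pt 1) φ.boundaryExtension e R (vMid (D.pt 0) (D.pt 1) φ.boundaryExtension e R) = D.pt 1) ∨
      (R (firstB (D.pt 1) R) ≠ D.pt 1 ∧ 1 ≤ rEx (D.pt 0) (D.pt 1) φ.boundaryExtension e R ∧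
        vMid (D.pt 0) (D.pt 1) φ.boundaryExtension e R ∈ Icc (lastA (D.pt 0) R) (firstB (D.pt 1) R) ∧
        attZ (D.pt 1) φ.boundaryExtension e R (vMid (D.pt 0) (D.pt 1) φ.boundaryExtension e R) =
          φ.boundaryExtension ((rEx (D.pt 0) (D.pt 1) φ.boundaryExtension e R : ℂ) *
            qEx (D.pt 1) φ.boundaryExtension e R) ∧
        0 ≤ (qEx (D.pt 1) φ.boundaryExtension e R).im ∧ qEx (D.pt 1) φ.boundaryExtension e R ≠ 0) := by
    by_cases hjb : R (firstB (D.pt 1) R) = D.pt 1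
    · obtain ⟨hv, hZv⟩ := vMid_spec_of_eq hφ he0 he1 hR hPcl hij hjb
      exact Or.inl ⟨hjb, hv, hZv⟩
    · obtain ⟨hr1, -, -, hvmem, hZv⟩ := vMid_spec_of_ne hφ he0 he1 hR hPcl hP1 hij hjb
      obtain ⟨hqim, hq0, -⟩ := qEx_spec hφ he0 he1 hR hPcl hP1 hjb
      exact Or.inr ⟨hjb, hr1, hvmem, hZv, hqim, hq0⟩
  -- abbreviations
  set a := D.pt 0 with ha
  set b := D.pt 1 with hb
  set Z := attZ b φ.boundaryExtension e R with hZ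
  set p := pAcc a φ.boundaryExtension e R with hp
  set q := qEx b φ.boundaryExtension e R with hq
  set s₁ := sAcc a b φ.boundaryExtension e R with hs₁
  set r₁ := rEx a b φ.boundaryExtension e R with hr₁
  set u₁ := uMid a b φ.boundaryExtension e R with hu₁
  set v₁ := vMid a b φ.boundaryExtension e R with hv₁
  set i := lastA a R with hi
  set j := firstB b R with hj
  set Head : Set ℂ := {a} ∪ (fun s : ℝ => φ.boundaryExtension ((s : ℂ) * p)) '' Ioc 0 s₁ with hHead
  set Tail : Set ℂ := (fun r : ℝ => φ.boundaryExtension ((r : ℂ) * q)) '' {r | r₁ ≤ r ∧ R j ≠ b} ∪ {b}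
    with hTail
  -- the curve
  obtain ⟨hcinj, hcs, hct, -, hcrange, -⟩ := hc
  have hc0 : c 0 = a := hcs
  have hc1 : c 1 = b := hct
  have hrange : range c = Head ∪ Z '' Icc u₁ v₁ ∪ Tail := by rw [hcrange huv]; exact attSet_eq
  -- distances on `Head` and `Tail`, hence disjointness
  have hHd : ∀ x ∈ Head, dist x a ≤ ρa := fun x hx => dist_head_le hφ he0 he1 hR hPcl hP0 hρa hx hij
  have hTd : ∀ x ∈ Tail, dist x b ≤ ρb := fun x hx => dist_tail_le hφ he0 he1 hR hPcl hP1 hρb hx hij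
  have hdisj : ∀ x, x ∈ Head → x ∉ Tail := fun x hxH hxT => by
    have := dist_triangle_left a b x
    linarith [hHd x hxH, hTd x hxT]
  -- the junction points
  have hJaH : (φ.boundaryExtension ((s₁ : ℂ) * p)) ∈ Head := by
    rcases hs0.eq_or_lt with h0 | hpos
    · left
      rw [mem_singleton_iff, ← h0, Complex.ofReal_zero, zero_mul, hφ.boundaryExtension_zero]
    · exact Or.inr ⟨s₁, ⟨hpos, le_rfl⟩, rfl⟩
  have haH : a ∈ Head := Or.inl rfl
  have hbT : b ∈ Tail := Or.inr rfl
  have hTail_b : R j = b → Tail = {b} := fun hjb => by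
    rw [hTail]
    ext x
    simp only [mem_union, mem_image, mem_setOf_eq, mem_singleton_iff, hjb, ne_eq, not_true_eq_false,
      and_false, false_and, exists_false, false_or]
  have hv₁mem : v₁ ∈ Icc i j := by
    rcases hTail_cases with ⟨-, hv, -⟩ | ⟨-, -, hvmem, -⟩
    · rw [hv]; exact right_mem_Icc.2 hij
    · exact hvmem
  have hJbT : (Z v₁) ∈ Tail := by
    rcases hTail_cases with ⟨-, -, hZv⟩ | ⟨hjb, -, -, hZv, -⟩
    · rw [hZv]; exact hbT
    · exact Or.inl ⟨r₁, ⟨le_rfl, hjb⟩, hZv.symm⟩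
  have hJaT : (φ.boundaryExtension ((s₁ : ℂ) * p)) ∉ Tail := hdisj (φ.boundaryExtension ((s₁ : ℂ) * p)) hJaH
  have hJbH : (Z v₁) ∉ Head := fun h => hdisj (Z v₁) h hJbT
  -- continuity and flatness of the middle piece
  have hZc : ContinuousOn Z (Icc u₁ v₁) := (attZ_continuous hφ he0 he1 hR hPcl).continuousOn
  have hIuv : Icc u₁ v₁ ⊆ Icc (0 : ℝ) 1 := (Icc_subset_Icc hu₁mem.1 hv₁mem.2).trans hIcc01
  have hZflat : ∀ u ∈ Icc u₁ v₁, ∀ u' ∈ Icc u₁ v₁, u ≤ u' → Z u = Z u' → ∀ w ∈ Icc u u', Z w = Z u :=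
    fun u hu u' hu' _ heq w hw => attZ_flat hφ he0 he1 hR hPcl hflat (hIuv hu) (hIuv hu') heq hw
  -- preconnectedness of the pieces
  have hray_p : ContinuousOn (fun s : ℝ => φ.boundaryExtension ((s : ℂ) * p)) (Ici 0) :=
    ray_continuousOn (continuousOn_boundaryExtension_im_nonneg φ) hpim
  have hHead_eq : Head = (fun s : ℝ => φ.boundaryExtension ((s : ℂ) * p)) '' Icc 0 s₁ := by
    rw [hHead]
    ext x
    simp only [mem_union, mem_singleton_iff, mem_image, mem_Ioc, mem_Icc]
    constructor
    · rintro (rfl | ⟨s, ⟨hs, hs'⟩, rfl⟩)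
      · exact ⟨0, ⟨le_rfl, hs0⟩, by rw [Complex.ofReal_zero, zero_mul, hφ.boundaryExtension_zero]⟩
      · exact ⟨s, ⟨hs.le, hs'⟩, rfl⟩
    · rintro ⟨s, ⟨hs, hs'⟩, rfl⟩
      rcases hs.eq_or_lt with rfl | hpos
      · exact Or.inl (by rw [Complex.ofReal_zero, zero_mul, hφ.boundaryExtension_zero])
      · exact Or.inr ⟨s, ⟨hpos, hs'⟩, rfl⟩
  have hHc : IsPreconnected Head := by
    rw [hHead_eq]
    exact isPreconnected_Icc.image _ (hray_p.mono Icc_subset_Ici_self)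
  have hTc : IsPreconnected Tail := by
    rcases hTail_cases with ⟨hjb, -, -⟩ | ⟨hjb, hr1, -, -, hqim, hq0⟩
    · rw [hTail_b hjb]; exact isPreconnected_singleton
    · -- the ray image of `Ici r₁`, plus its limit point `b`
      have hE : (fun r : ℝ => φ.boundaryExtension ((r : ℂ) * q)) '' {r | r₁ ≤ r ∧ R j ≠ b} =
          (fun r : ℝ => φ.boundaryExtension ((r : ℂ) * q)) '' Ici r₁ := by
        congr 1
        ext r
        simp only [mem_setOf_eq, mem_Ici, ne_eq, hjb, not_false_eq_true, and_true]
      have hEc : IsPreconnected ((fun r : ℝ => φ.boundaryExtension ((r : ℂ) * q)) '' Ici r₁) :=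
        isPreconnected_Ici.image _ ((ray_continuousOn (continuousOn_boundaryExtension_im_nonneg φ) hqim).mono
          (Ici_subset_Ici.2 (zero_le_one.trans hr1)))
      have hbcl : b ∈ closure ((fun r : ℝ => φ.boundaryExtension ((r : ℂ) * q)) '' Ici r₁) := by
        refine mem_closure_of_tendsto (ray_tendsto_pt hφ.tendsto_boundaryExtension_cocompact hqim hq0) ?_
        filter_upwards [eventually_ge_atTop r₁] with r hr
        exact ⟨r, hr, rfl⟩
      rw [hTail, hE]
      refine hEc.subset_closure subset_union_left ?_
      rintro x (hx | hx)
      · exact subset_closure hx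
      · rw [mem_singleton_iff] at hx; rw [hx]; exact hbcl
  have hH' : (a ∈ Head \ {(φ.boundaryExtension ((s₁ : ℂ) * p))} ∧ IsPreconnected (Head \ {(φ.boundaryExtension ((s₁ : ℂ) * p))})) ∨ Head ⊆ {a} := by
    by_cases hpz : p = 0
    · right
      rw [hHead]
      rintro x (hx | ⟨s, -, rfl⟩)
      · exact hx
      · show φ.boundaryExtension ((s : ℂ) * p) ∈ ({a} : Set ℂ)
        rw [mem_singleton_iff, hpz, mul_zero, hφ.boundaryExtension_zero]
    · left
      have hs_pos : 0 < s₁ := lt_of_le_of_ne hs0 (fun h => hpz (hs00.1 h.symm))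
      have hJa_ne : (φ.boundaryExtension ((s₁ : ℂ) * p)) ≠ a := by
        rw [Ne, bext_eq_pt_zero_iff hφ (ray_im_nonneg hpim hs0), mul_eq_zero, not_or]
        exact ⟨by exact_mod_cast hs_pos.ne', hpz⟩
      -- injectivity of the access parametrisation on `[0, ∞)`
      have hinj : ∀ s t : ℝ, 0 ≤ s → 0 ≤ t →
          φ.boundaryExtension ((s : ℂ) * p) = φ.boundaryExtension ((t : ℂ) * p) → s = t := by
        intro s t hs ht h
        have h1 := bext_injOn φ (ray_im_nonneg hpim hs) (ray_im_nonneg hpim ht) h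
        exact_mod_cast mul_right_cancel₀ hpz h1
      have hHJ : Head \ {(φ.boundaryExtension ((s₁ : ℂ) * p))} = (fun s : ℝ => φ.boundaryExtension ((s : ℂ) * p)) '' Ico 0 s₁ := by
        rw [hHead_eq]
        ext x
        simp only [Set.mem_sdiff, mem_image, mem_Icc, mem_Ico, mem_singleton_iff]
        constructor
        · rintro ⟨⟨s, ⟨hs, hs'⟩, rfl⟩, hne⟩
          refine ⟨s, ⟨hs, lt_of_le_of_ne hs' fun h => hne ?_⟩, rfl⟩
          rw [h]
        · rintro ⟨s, ⟨hs, hs'⟩, rfl⟩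
          refine ⟨⟨s, ⟨hs, hs'.le⟩, rfl⟩, fun h => ?_⟩
          have := hinj s s₁ hs hs0 h
          exact hs'.ne this
      refine ⟨⟨haH, fun h => hJa_ne h.symm⟩, ?_⟩
      rw [hHJ]
      exact isPreconnected_Ico.image _ (hray_p.mono Ico_subset_Ici_self)
  have hT' : (b ∈ Tail \ {(Z v₁)} ∧ IsPreconnected (Tail \ {(Z v₁)})) ∨ Tail ⊆ {b} := by
    rcases hTail_cases with ⟨hjb, -, -⟩ | ⟨hjb, hr1, -, hZv, hqim, hq0⟩
    · exact Or.inr (hTail_b hjb).le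
    · left
      have hJb_ne : Z v₁ ≠ b := by
        rw [hZv]
        exact bext_ne_pt_one hφ (ray_im_nonneg hqim (zero_le_one.trans hr1))
      have hinj : ∀ s t : ℝ, 0 ≤ s → 0 ≤ t →
          φ.boundaryExtension ((s : ℂ) * q) = φ.boundaryExtension ((t : ℂ) * q) → s = t := by
        intro s t hs ht h
        have h1 := bext_injOn φ (ray_im_nonneg hqim hs) (ray_im_nonneg hqim ht) h
        exact_mod_cast mul_right_cancel₀ hq0 h1
      have hTJ : Tail \ {(Z v₁)} = (fun r : ℝ => φ.boundaryExtension ((r : ℂ) * q)) '' Ioi r₁ ∪ {b} := by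
        rw [hTail]
        ext x
        simp only [Set.mem_sdiff, mem_union, mem_image, mem_setOf_eq, mem_Ioi, mem_singleton_iff]
        constructor
        · rintro ⟨⟨r, ⟨hr, -⟩, rfl⟩ | rfl, hne⟩
          · refine Or.inl ⟨r, lt_of_le_of_ne hr fun h => hne ?_, rfl⟩
            rw [hZv, h]
          · exact Or.inr rfl
        · rintro (⟨r, hr, rfl⟩ | rfl)
          · refine ⟨Or.inl ⟨r, ⟨hr.le, hjb⟩, rfl⟩, fun h => ?_⟩
            rw [hZv] at h
            have := hinj r r₁ (zero_le_one.trans (hr1.trans hr.le)) (zero_le_one.trans hr1) h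
            exact hr.ne' this
          · exact ⟨hbT, fun h => hJb_ne h.symm⟩
      refine ⟨⟨hbT, fun h => hJb_ne h.symm⟩, ?_⟩
      rw [hTJ]
      have hEc : IsPreconnected ((fun r : ℝ => φ.boundaryExtension ((r : ℂ) * q)) '' Ioi r₁) :=
        isPreconnected_Ioi.image _ ((ray_continuousOn (continuousOn_boundaryExtension_im_nonneg φ) hqim).mono
          (fun r hr => (zero_le_one.trans hr1).trans (le_of_lt hr)))
      have hbcl : b ∈ closure ((fun r : ℝ => φ.boundaryExtension ((r : ℂ) * q)) '' Ioi r₁) := by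
        refine mem_closure_of_tendsto (ray_tendsto_pt hφ.tendsto_boundaryExtension_cocompact hqim hq0) ?_
        filter_upwards [eventually_gt_atTop r₁] with r hr
        exact ⟨r, hr, rfl⟩
      refine hEc.subset_closure subset_union_left ?_
      rintro x (hx | hx)
      · exact subset_closure hx
      · rw [mem_singleton_iff] at hx; rw [hx]; exact hbcl
  -- the abstract order lemma
  obtain ⟨ta, tb, hab, hta, htb, hA4, hA5, hA6, hA7, hA8⟩ :=
    arc_order (X := ℂ) (att := ⇑c) c.continuous hcinj hc0 hc1 hrange hZc huv.le hZu₁ rfl hZflat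
      haH hbT hJbT hJaT hJbH hHc hTc hH' hT'
  have hmem3 : ∀ t, c t ∈ Head ∨ c t ∈ Z '' Icc u₁ v₁ ∨ c t ∈ Tail := by
    intro t
    have : c t ∈ range c := mem_range_self t
    rw [hrange] at this
    rcases this with (h | h) | h
    · exact Or.inl h
    · exact Or.inr (Or.inl h)
    · exact Or.inr (Or.inr h)
  refine ⟨hIuv, ta, tb, hab, hta.trans hZu₁.symm, htb, fun t ht => hHd _ (hA4 t ht).1,
    fun t ht => hTd _ (hA5 t ht).1, fun t ht => ?_, fun t ht => ?_, fun t h1 h2 => ?_, hA8⟩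
  · rcases ht.lt_or_eq with hlt | heq
    · exact hHd _ (hA4 t hlt).1
    · rw [heq, hta]; exact hHd _ hJaH
  · rcases ht.lt_or_eq with hlt | heq
    · exact hTd _ (hA5 t hlt).1
    · rw [← heq, htb]; exact hTd _ hJbT
  · rcases hmem3 t with h | h | h
    · exact absurd (hA6 t h) (not_le.2 h1)
    · exact h
    · exact absurd (hA7 t h) (not_le.2 h2)

end Structure

end AttachNoReturn

end Summit.CriticalPhenomena.SAWScalingLimit.Theorems
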